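import Summits.Ventures.DiscreteObjects.Hadamard.TurynTypeFamily668Types
import Literature.Combinatorics.Designs.TurynTypeSymmetries

/-!
# Hadamard 668 census — Turyn-type sequences `TT(n)`, `n` even: the weight-one pair is never reversal-closed;
# in particular `TT(56)` (the Turyn-type route to `H(668)`) has no reversal-structured `(A, B)` pair (kernel)

Framing: lottery ticket; floor = certified bounds/negative ranges.

Cell pub-namedobj (venture DiscreteObjects), target (H), hadamard gen 26.  Turyn-type sequences `(x; y; z; w) ∈ TT(n)`
(`x, y, z` of length `n`, `w` of length `n - 1`, `±1`, `N_x + N_y + 2N_z + 2N_w = 0`; BDKR 2013, `x, y` = their `A, B`) give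
base sequences `BS(2n-1, 2n-1, n, n)`, T-sequences of length `3n - 1` and `H(4(3n-1))`; `H(668)` needs `TT(56)`
(`TurynTypeFamily668`; the printed frontier is `n ≤ 40` or so).  BDKR's elementary transformations (negate / reverse single
sequences, alternate all, swap `A ↔ B`) make the REVERSAL-structured pairs the natural structured sub-family: `A` and `B` each
reversal-symmetric or reversal-skew (`A' = ±A`, `B' = ±B`), or mutual reverses up to sign (`B = ±A'`).  Here, by the parity of
aperiodic autocorrelations at the single shift `s = 2`:
* `npaf_pm_parity` — `N_u(s) ≡ L - s (mod 2)` for a `±1` sequence of length `L` (`s ≤ L`);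
* `npaf_reflect_mod_four` — if moreover `u' = ±u` and `L - s` is even then `N_u(s) ≡ L - s (mod 4)` (the products
  `u_i u_{i+s}` pair off under `i ↦ L - s - 1 - i`);
* **`no_symmetricSkewPair_turynType_even`** — for EVEN `n ≥ 4` there are no `TT(n)` with `x' = αx` and `y' = βy`
  (`α, β = ±1`): at `s = 2`, `N_x + N_y ≡ 2(n-2) ≡ 0 (mod 4)` while `2N_z + 2N_w ≡ 2(n-2) + 2(n-3) ≡ 2 (mod 4)`;
* **`no_mutualReversePair_turynType_even`** — for even `n ≥ 4` there are no `TT(n)` with `y = αx'`: then `N_y = N_x` and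
  `N_x(2) + N_z(2) + N_w(2) = 0` has parity `3n - 7 ≡ 1`;
* **`no_reversalClosedPair_turynType_even`** — the signed-permutation form (`(x,y)_{σ j}' = e_j (x,y)_j`, `σ ∈ S₂`);
* **`no_reversalClosedPair_turynType_56`**, `no_symmetricSkewPair_turynType_56`, `no_mutualReversePair_turynType_56` — the
  instances at `n = 56`: the structured sub-family of the Turyn-type route to `H(668)` is EMPTY.  Nothing is assumed about
  `z, w`.  (Independent brute force outside the kernel: `TT(4)` has 16 and `TT(6)` has 192 normalised members, none with a
  reversal-closed `(A, B)` pair.)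
NEGATIVE line about hypothetical objects; unstructured `TT(56)` remains OPEN and beyond the frontier; no Hadamard order
excluded; H(668) untouched; HITS 0/4.  Ours, elementary (a cousin of BDKR 2013 §2, proof of Prop. 2.2: "exactly one of
`a₂ = b₂`, `a_{n-1} = b_{n-1}` holds"); no `sorry`, no `decide`.
-/

open Finset BigOperators

namespace Summit.Ventures.DiscreteObjects.Hadamard

open Literature.Combinatorics.Designs.TSequences
open Literature.Combinatorics.Designs.BaseSequences
open Literature.Combinatorics.Designs.TurynTypeSymmetries

/-! ## §1 Parities of aperiodic autocorrelations -/

/-- `N_u(s) ≡ L - s (mod 2)` for a `±1` sequence of length `L` and `s ≤ L`: the `L - s` products `u_i u_{i+s}` are `±1`. -/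
theorem npaf_pm_parity {L s : ℕ} {u : ℕ → ℤ} (hu : PMOn L u) (hs : s ≤ L) :
    ∃ k : ℤ, NPAF L u s = ((L - s : ℕ) : ℤ) - 2 * k := by
  have hprod : PMOn (L - s) fun i => u i * u (i + s) := fun i hi => by
    rcases hu i (by omega) with e | e <;> rcases hu (i + s) (by omega) with f | f <;> simp [e, f]
  obtain ⟨k, hk⟩ := sum_pm_parity hprod
  exact ⟨k, by unfold NPAF; rw [hk]⟩

/-- the aperiodic autocorrelation only reads the first `L` entries. -/
lemma npaf_congr {L : ℕ} {u v : ℕ → ℤ} (h : ∀ i, i < L → v i = u i) (s : ℕ) : NPAF L v s = NPAF L u s := by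
  unfold NPAF
  refine Finset.sum_congr rfl fun i hi => ?_
  rw [mem_range] at hi
  rw [h i (by omega), h (i + s) (by omega)]

/-- **`N_u(s) ≡ L - s (mod 4)` for a reversal-symmetric or reversal-skew `±1` sequence** (`u(L-1-i) = ε u(i)`) when `L - s`
is even: the products `u_i u_{i+s}` are invariant under `i ↦ L - s - 1 - i`, which has no fixed point, so
`N_u(s) = 2 Σ_{i < (L-s)/2} u_i u_{i+s}` and the half sum has the parity of `(L - s)/2`. -/
theorem npaf_reflect_mod_four {L s : ℕ} {u : ℕ → ℤ} (hu : PMOn L u) {ε : ℤ} (hε : ε = 1 ∨ ε = -1)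
    (hrev : ∀ i, i < L → u (L - 1 - i) = ε * u i) (hs : s ≤ L) (heven : Even (L - s)) :
    ∃ k : ℤ, NPAF L u s = ((L - s : ℕ) : ℤ) - 4 * k := by
  obtain ⟨h, hh⟩ := heven
  set f : ℕ → ℤ := fun i => u i * u (i + s) with hf
  have hε2 : ε * ε = 1 := by rcases hε with e | e <;> simp [e]
  -- symmetry of the products
  have hsym : ∀ i, i < h → f (h + (h - 1 - i)) = f i := fun i hi => by
    simp only [hf]
    have e1 : h + (h - 1 - i) = L - 1 - (i + s) := by omega
    have e2 : L - 1 - (i + s) + s = L - 1 - i := by omega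
    rw [e1, e2, hrev (i + s) (by omega), hrev i (by omega)]
    calc ε * u (i + s) * (ε * u i) = (ε * ε) * (u i * u (i + s)) := by ring
      _ = u i * u (i + s) := by rw [hε2, one_mul]
  have hsplit : NPAF L u s = 2 * ∑ i ∈ range h, f i := by
    unfold NPAF
    rw [show L - s = h + h from hh, Finset.sum_range_add, two_mul]
    congr 1
    rw [← Finset.sum_range_reflect (fun i => f (h + i)) h]
    exact Finset.sum_congr rfl fun i hi => hsym i (mem_range.mp hi)
  have hprod : PMOn h f := fun i hi => by
    simp only [hf]
    rcases hu i (by omega) with e | e <;> rcases hu (i + s) (by omega) with e' | e' <;> simp [e, e']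
  obtain ⟨k, hk⟩ := sum_pm_parity hprod
  refine ⟨k, ?_⟩
  rw [hsplit, hk, show ((L - s : ℕ) : ℤ) = (h : ℤ) + h by rw [hh]; push_cast; ring]
  ring

/-! ## §2 Even `n`: the weight-one pair of `TT(n)` is never reversal-closed -/

section Even

variable {n : ℕ} {x y z w : ℕ → ℤ}

/-- **no `TT(n)`, `n ≥ 4` even, with `x' = αx` and `y' = βy`** (each of the two weight-one sequences reversal-symmetric or
reversal-skew, any signs).  Shift `2`: `N_x(2) + N_y(2) ≡ 0 (mod 4)` but `-2N_z(2) - 2N_w(2) ≡ 2 (mod 4)`. -/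
theorem no_symmetricSkewPair_turynType_even (hn : Even n) (h4 : 4 ≤ n) (h : IsTurynType n x y z w) {α β : ℤ}
    (hα : α = 1 ∨ α = -1) (hβ : β = 1 ∨ β = -1) (hx : ∀ i, i < n → x (n - 1 - i) = α * x i)
    (hy : ∀ i, i < n → y (n - 1 - i) = β * y i) : False := by
  obtain ⟨hxp, hyp, hzp, hwp, hN⟩ := h
  have h2 := hN 2 (by omega) (by norm_num)
  have hev : Even (n - 2) := by
    obtain ⟨t, ht⟩ := hn
    exact ⟨t - 1, by omega⟩
  obtain ⟨kx, hkx⟩ := npaf_reflect_mod_four hxp hα hx (by omega) hev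
  obtain ⟨ky, hky⟩ := npaf_reflect_mod_four hyp hβ hy (by omega) hev
  obtain ⟨kz, hkz⟩ := npaf_pm_parity hzp (show 2 ≤ n by omega)
  obtain ⟨kw, hkw⟩ := npaf_pm_parity hwp (show 2 ≤ n - 1 by omega)
  rw [hkx, hky, hkz, hkw] at h2
  obtain ⟨t, ht⟩ := hn
  have e1 : ((n - 2 : ℕ) : ℤ) = 2 * t - 2 := by omega
  have e2 : ((n - 1 - 2 : ℕ) : ℤ) = 2 * t - 3 := by omega
  rw [e1, e2] at h2
  omega

/-- **no `TT(n)`, `n ≥ 4` even, with `y = αx'`** (the two weight-one sequences mutual reverses up to sign): then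
`N_y = N_x`, and `N_x(2) + N_z(2) + N_w(2) = 0` is odd (`(n-2) + (n-2) + (n-3)` terms). -/
theorem no_mutualReversePair_turynType_even (hn : Even n) (h4 : 4 ≤ n) (h : IsTurynType n x y z w) {α : ℤ}
    (hα : α = 1 ∨ α = -1) (hy : ∀ i, i < n → y i = α * x (n - 1 - i)) : False := by
  obtain ⟨hxp, -, hzp, hwp, hN⟩ := h
  have h2 := hN 2 (by omega) (by norm_num)
  -- `N_y = N_x`
  have hNy : NPAF n y 2 = NPAF n x 2 := by
    rcases hα with rfl | rfl
    · rw [npaf_congr (u := rev n x) (fun i hi => by rw [hy i hi, one_mul]; rfl), npaf_rev]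
    · rw [npaf_congr (u := neg (rev n x)) (fun i hi => by rw [hy i hi]; simp [neg, rev]), npaf_neg', npaf_rev]
  obtain ⟨kx, hkx⟩ := npaf_pm_parity hxp (show 2 ≤ n by omega)
  obtain ⟨kz, hkz⟩ := npaf_pm_parity hzp (show 2 ≤ n by omega)
  obtain ⟨kw, hkw⟩ := npaf_pm_parity hwp (show 2 ≤ n - 1 by omega)
  rw [hNy, hkx, hkz, hkw] at h2
  obtain ⟨t, ht⟩ := hn
  have e1 : ((n - 2 : ℕ) : ℤ) = 2 * t - 2 := by omega
  have e2 : ((n - 1 - 2 : ℕ) : ℤ) = 2 * t - 3 := by omega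
  rw [e1, e2] at h2
  omega

/-- **signed-permutation form: for even `n ≥ 4` the weight-one pair `{±x, ±y}` of a `TT(n)` is never closed under
reversal** (`(x,y)_{σ j}(n-1-i) = e_j (x,y)_j(i)` for a permutation `σ` of the pair and signs `e_j`). -/
theorem no_reversalClosedPair_turynType_even (hn : Even n) (h4 : 4 ≤ n) (h : IsTurynType n x y z w)
    {σ : Equiv.Perm (Fin 2)} {e : Fin 2 → ℤ} (he : ∀ j, e j = 1 ∨ e j = -1)
    (hxy : ∀ j, ∀ i, i < n → (![x, y] (σ j)) (n - 1 - i) = e j * (![x, y] j) i) : False := by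
  have hσ2 : ∀ τ : Equiv.Perm (Fin 2), τ = 1 ∨ τ = Equiv.swap 0 1 := by decide
  rcases hσ2 σ with rfl | rfl
  · exact no_symmetricSkewPair_turynType_even hn h4 h (he 0) (he 1)
      (fun i hi => by simpa using hxy 0 i hi) (fun i hi => by simpa using hxy 1 i hi)
  · -- `y (n-1-i) = e 0 * x i`, i.e. `y i = e 0 * x (n-1-i)`
    have hy' : ∀ i, i < n → y (n - 1 - i) = e 0 * x i := fun i hi => by simpa using hxy 0 i hi
    refine no_mutualReversePair_turynType_even hn h4 h (he 0) fun i hi => ?_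
    have := hy' (n - 1 - i) (by omega)
    rwa [show n - 1 - (n - 1 - i) = i by omega] at this

end Even

/-! ## §3 `TT(56)`: the Turyn-type route to `H(668)` -/

section TT56

variable {x y z w : ℕ → ℤ}

/-- **`TT(56)` has no reversal-symmetric/skew weight-one pair** (`x' = αx`, `y' = βy`, any signs). -/
theorem no_symmetricSkewPair_turynType_56 (h : IsTurynType 56 x y z w) {α β : ℤ} (hα : α = 1 ∨ α = -1)
    (hβ : β = 1 ∨ β = -1) (hx : ∀ i, i < 56 → x (55 - i) = α * x i) (hy : ∀ i, i < 56 → y (55 - i) = β * y i) : False :=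
  no_symmetricSkewPair_turynType_even (n := 56) ⟨28, rfl⟩ (by norm_num) h hα hβ hx hy

/-- **`TT(56)` has no weight-one pair of mutual reverses** (`y = αx'`). -/
theorem no_mutualReversePair_turynType_56 (h : IsTurynType 56 x y z w) {α : ℤ} (hα : α = 1 ∨ α = -1)
    (hy : ∀ i, i < 56 → y i = α * x (55 - i)) : False :=
  no_mutualReversePair_turynType_even (n := 56) ⟨28, rfl⟩ (by norm_num) h hα hy

/-- **`TT(56)`: the weight-one pair is never reversal-closed** (signed-permutation form) — the reversal-structured sub-family of
the Turyn-type route to `H(668)` is EMPTY; unstructured `TT(56)` remain open.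
lottery ticket; floor = certified bounds/negative ranges. -/
theorem no_reversalClosedPair_turynType_56 (h : IsTurynType 56 x y z w) {σ : Equiv.Perm (Fin 2)} {e : Fin 2 → ℤ}
    (he : ∀ j, e j = 1 ∨ e j = -1) (hxy : ∀ j, ∀ i, i < 56 → (![x, y] (σ j)) (55 - i) = e j * (![x, y] j) i) : False :=
  no_reversalClosedPair_turynType_even (n := 56) ⟨28, rfl⟩ (by norm_num) h he hxy

end TT56

end Summit.Ventures.DiscreteObjects.Hadamard
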